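import Summits.CriticalPhenomena.PercolationContinuityZ3.Theses.PercNearOneGluing
import Literature.Probability.Percolation.PercolationProofs
import Literature.Probability.Percolation.ConditionalPositiveAssociationProofs
import Literature.Probability.Percolation.TwoClusterConditionalAssociationProofs
import Literature.Probability.LatticeModels.ProdBernoulliClusterLocality

/-! TTRL-lite variant V1364 of stmt-CriticalPhenomena-4576

**Verdict: DISPROVED.**  V1364 is the `σ_B` form of Kozma–Nitzan Lemma 5 (landed as
`stub_lemma5AnyRelay`) *without* its hypothesis that some vertex of the block `B` is at least as
reliable as the worst relay `a₀`: "every open star `σ_B` at the observer `o` beats the worst relay".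
It already fails degenerately, with the worst relay equal to the target.  Witness: `n = 3`, `o = 0`,
`b = a₀ = 1`, `A = {1}`, `B = {2}`, and the deterministic weighting `w = 𝟙_{s(0,2)}` (the pair
`s(0,2)` surely open, every other pair surely closed).  Almost surely `s(0,1) ∉ ω` and `s(0,2) ∈ ω`,
so `ω ∈ σ_B`, and `{1 ↔ 1}` is everything, hence `μ(σ_B ∩ {1 ↔ 1}) = 1`; almost surely `s(0,1) ∉ ω`
and `s(1,2) ∉ ω`, so the vertex `1` is isolated and `μ(σ_B ∩ {0 ↔ 1}) ≤ μ(0 ↔ 1) = 0`.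
-/

namespace Summit.CriticalPhenomena.PercolationContinuityZ3.Theorems

open MeasureTheory Literature.Probability.LatticeModels Literature.Probability.Percolation
open scoped Classical BigOperators

/-- **TTRL-lite variant V1364 of stmt-CriticalPhenomena-4576 is false** (KN Lemma 5 in `σ_B` form
with the reliability hypothesis on `B` dropped).  Counterexample: `n = 3`, `o = 0`, `b = a₀ = 1`,
`A = {1}`, `B = {2}`, `w = 𝟙_{s(0,2)}`; then `μ(σ_B ∩ {1 ↔ 1}) = 1` while `μ(σ_B ∩ {0 ↔ 1}) = 0`
because `1` is almost surely isolated. [this project] -/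
theorem cp4576_goodstep_var1364_false : ¬ (∀ (n : ℕ) (w : Sym2 (Fin n) → unitInterval) (A B : Finset (Fin n)) (o b a₀ : Fin n), b ∈ A → o ∉ A → a₀ ∈ A → b ≠ o → o ∉ B → B.Nonempty → (∀ a ∈ A, (prodBernoulli w).real (openConn a₀ b) ≤ (prodBernoulli w).real (openConn a b)) → (prodBernoulli w).real ({ω : BondConfig (Fin n) | ∀ y : Fin n, y ≠ o → (s(o, y) ∈ ω ↔ y ∈ B)} ∩ openConn a₀ b) ≤ (prodBernoulli w).real ({ω : BondConfig (Fin n) | ∀ y : Fin n, y ≠ o → (s(o, y) ∈ ω ↔ y ∈ B)} ∩ openConn o b)) := by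
  intro h
  -- the witness weighting on `Fin 3`: the pair `s(0, 2)` surely open, every other pair surely closed
  set w : Sym2 (Fin 3) → unitInterval := fun e => if e = s(0, 2) then 1 else 0 with hw
  have hw02 : w s(0, 2) = 1 := by simp [hw]
  have hw01 : w s(0, 1) = 0 := by
    have hne : (s(0, 1) : Sym2 (Fin 3)) ≠ s(0, 2) := by decide
    simp [hw, hne]
  have hw12 : w s(1, 2) = 0 := by
    have hne : (s(1, 2) : Sym2 (Fin 3)) ≠ s(0, 2) := by decide
    simp [hw, hne]
  -- almost surely `s(0,1) ∉ ω`, `s(1,2) ∉ ω` and `s(0,2) ∈ ω`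
  have h01 : ∀ᵐ ω ∂prodBernoulli w, s(0, 1) ∉ ω := prodBernoulli_ae_notMem w hw01
  have h12 : ∀ᵐ ω ∂prodBernoulli w, s(1, 2) ∉ ω := prodBernoulli_ae_notMem w hw12
  have h02 : ∀ᵐ ω ∂prodBernoulli w, s(0, 2) ∈ ω := by
    rw [ae_iff]
    have h' := prodBernoulli_real_setOf_notMem w s(0, 2)
    rw [hw02, Set.Icc.coe_one, sub_self] at h'
    exact (measureReal_eq_zero_iff (measure_ne_top _ _)).1 h'
  -- the instance of V1364 at the witness: `μ(σ_B ∩ {1 ↔ 1}) ≤ μ(σ_B ∩ {0 ↔ 1})`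
  have key := h 3 w {1} {2} 0 1 1 (Finset.mem_singleton_self _) (by decide)
    (Finset.mem_singleton_self _) (by decide) (by decide) ⟨2, Finset.mem_singleton_self _⟩
    (fun a ha => by rw [Finset.mem_singleton.1 ha])
  -- left-hand side: `μ(σ_B ∩ {1 ↔ 1}) = 1`
  have hL : (prodBernoulli w).real
      ({ω : BondConfig (Fin 3) | ∀ y : Fin 3, y ≠ 0 → (s(0, y) ∈ ω ↔ y ∈ ({2} : Finset (Fin 3)))} ∩
        openConn 1 1) = 1 := by
    have hae : ∀ᵐ ω ∂prodBernoulli w,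
        ω ∈ ({ω : BondConfig (Fin 3) | ∀ y : Fin 3, y ≠ 0 → (s(0, y) ∈ ω ↔ y ∈ ({2} : Finset (Fin 3)))} ∩
          openConn 1 1) := by
      filter_upwards [h01, h02] with ω hω01 hω02
      refine ⟨?_, SimpleGraph.Reachable.refl _⟩
      intro y hy
      have hy' : y = 1 ∨ y = 2 := by omega
      rcases hy' with rfl | rfl
      · simpa using hω01
      · simpa using hω02
    have huniv : ({ω : BondConfig (Fin 3) | ∀ y : Fin 3, y ≠ 0 → (s(0, y) ∈ ω ↔ y ∈ ({2} : Finset (Fin 3)))} ∩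
        openConn 1 1 : Set (BondConfig (Fin 3))) =ᵐ[prodBernoulli w] (Set.univ : Set (BondConfig (Fin 3))) :=
      ae_eq_univ.2 (mem_ae_iff.1 hae)
    rw [measureReal_def, measure_congr huniv, measure_univ, ENNReal.toReal_one]
  -- right-hand side: `μ(σ_B ∩ {0 ↔ 1}) = 0`, the vertex `1` being almost surely isolated
  have hR : (prodBernoulli w).real
      ({ω : BondConfig (Fin 3) | ∀ y : Fin 3, y ≠ 0 → (s(0, y) ∈ ω ↔ y ∈ ({2} : Finset (Fin 3)))} ∩
        openConn 0 1) = 0 := by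
    have hae : ∀ᵐ ω ∂prodBernoulli w,
        ω ∉ ({ω : BondConfig (Fin 3) | ∀ y : Fin 3, y ≠ 0 → (s(0, y) ∈ ω ↔ y ∈ ({2} : Finset (Fin 3)))} ∩
          openConn 0 1) := by
      filter_upwards [h01, h12] with ω hω01 hω12 hω
      have hr : (openGraph ω).Reachable 0 1 := hω.2
      rw [SimpleGraph.reachable_iff_reflTransGen] at hr
      have hstay : ∀ v : Fin 3, Relation.ReflTransGen (openGraph ω).Adj 0 v → v ≠ 1 := by
        intro v hv
        induction hv with
        | refl => decide
        | @tail x y _ hadj _ =>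
          intro hy
          subst hy
          rw [openGraph_adj] at hadj
          have hx : x = 0 ∨ x = 2 := by omega
          rcases hx with rfl | rfl
          · exact hω01 hadj.1
          · have h21 := hadj.1
            rw [Sym2.eq_swap] at h21
            exact hω12 h21
      exact hstay 1 hr rfl
    rw [measureReal_def, measure_eq_zero_iff_ae_notMem.2 hae, ENNReal.toReal_zero]
  have h10 : (1 : ℝ) ≤ 0 := hL.symm.trans_le (key.trans_eq hR)
  exact absurd h10 (by norm_num)

end Summit.CriticalPhenomena.PercolationContinuityZ3.Theorems
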